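import Literature.Topology.FourManifolds.HomotopySpheresStablyParallelizableProofs
import Literature.Topology.FourManifolds.WhitneySphereEmbeddingProofs
import HarnessLib

/-!
# `Θ₇ = bP₈` over its three remaining leaves

Topic `Literature/Topology/FourManifolds`; pure-proof companion of `HomotopySpheresBP.lean`
(the named fact `Literature.Topology.FourManifolds.HomotopySphere.boundsParallelizable_seven`:
every homotopy `7`-sphere bounds a parallelizable manifold, i.e. `Θ₇ = bP₈` — Kervaire–Milnor,
*Groups of homotopy spheres I*, Ann. of Math. 77 (1963), §4, proof of Thm. 4.1 and the table
p. 512, `Θ₇ / bP₈ ↪ Π₇ / p(S⁷) = 0`; Kosinski, *Differential Manifolds* (1993), Ch. X §6, (6.6)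
and p. 219: "Since Coker `J₇` = 0, … `θ⁷ = ℤ₂₈`"). Everything here is **proved**; no definition,
no named fact, no statement is added or changed.

The tree proves `boundsParallelizable_seven` from five named facts
(`HomotopySphere.boundsParallelizable_seven_of'`, `HomotopySpheresStablyParallelizable.lean`, with
`HomotopySphere.boundsParallelizable_of_isStablyParallelizable_seven_of'`,
`WhitneySphereEmbedding.lean`): for Thm. 3.1 at `n = 7`, Bott's `π₆(SO(8)) = 0` in extension
form (`Bott1959_sphereMapsToStableFramesExtend_six`) and "`o₇` is the only obstruction"
(`HomotopySphere.hasStableTangentFramingAlong_compl_singleton`, stated for homotopy spheres of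
every dimension); for §4 at `n = 7`, Lemma 3.3 (`exists_isNormalFraming_of_isStablyParallelizable`),
Lemma 4.2 (`boundsParallelizable_of_collapseNullHomotopic`) and `0 ∈ p(Σ⁷)`
(`HomotopySphere.exists_collapseNullHomotopic_seven`, Lemma 4.5 with `coker J₇ = 0`). Two of the
five are not needed any more:

* Lemma 3.3 is DISCHARGED (`exists_isNormalFraming_of_isStablyParallelizable_holds`,
  `WhitneySphereEmbeddingProofs.lean`);
* "`o₇` is the only obstruction" is needed only in dimension `7`, where the tree proves it
  outright: a punctured homotopy `n`-sphere, `n ≥ 3`, is contractible by the PROVED Hurewicz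
  theorem (`HomotopySphere.contractibleSpace_compl_singleton_of_hurewicz_of_le` with
  `Literature.AlgebraicTopology.SingularHomology.hurewicz_subsingleton_holds`,
  `PuncturedHomotopySphereContractible.lean`), and the stable tangent bundle is then framed off
  the point by the proved covering homotopy theorem for stable framings
  (`hasStableTangentFramingAlong_compl_singleton_of_contractibleSpace`,
  `HomotopySpheresStablyParallelizableProofs.lean`). Only the dimension-`2` instance of the
  all-dimensions fact is not a theorem of the tree, and it is irrelevant to `Θ₇`.

Hence `HomotopySphere.boundsParallelizable_seven_of_leaves`: `Θ₇ = bP₈` from the **three**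
remaining named facts — Bott's `π₆(SO(8)) = 0`, Kervaire–Milnor's Lemma 4.2 (Pontryagin–Thom
direction) and `coker J₇ = 0` (`0 ∈ p(Σ⁷)`) — so that the discharge
`boundsParallelizable_seven_holds` is `boundsParallelizable_seven_of_leaves` applied to their three
`_holds`, once they exist. On the way: Kervaire–Milnor's Thm. 3.1 in dimension `n + 1 ≥ 3` from
the single hypothesis `πₙ(GL(n + 2, ℝ)) = 0` in extension form
(`isStablyParallelizable_succ_of_sphereMapsToStableFramesExtend`), in particular every homotopy
`7`-sphere is s-parallelizable given Bott's theorem alone (`isStablyParallelizable_seven_of_bott`).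

## References

* M. Kervaire, J. Milnor, *Groups of homotopy spheres I*, Ann. of Math. 77 (1963): §3, Thm. 3.1
  and its proof, p. 508 (Case 1, `πₙ₋₁(SO) = 0` for `n ≡ 3, 5, 6, 7 mod 8`), Lemma 3.3 (p. 509);
  §4, pp. 510–512 (proof of Thm. 4.1, Lemma 4.2, Lemma 4.5, Remarks and table p. 512); §2,
  proof of Lemma 2.4, p. 507 (punctured homotopy spheres). [KervaireMilnorAnnals1963]
* A. Kosinski, *Differential Manifolds* (1993), Ch. IX §8 ((8.2)–(8.6): clutching, "Homotopy
  spheres are π-manifolds"), Ch. X §6, (6.6) and p. 219 (`Coker J₇ = 0`, `θ⁷ = ℤ₂₈`). [Kosinski1993]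
* R. Bott, *The stable homotopy of the classical groups*, Ann. of Math. 70 (1959), 313–337
  (`π₆(O) = 0`). [Bott1959]
-/

open scoped Manifold ContDiff Topology

noncomputable section

namespace Literature.Topology.FourManifolds

namespace HomotopySphere

variable {n : ℕ}

/-- **The stable tangent bundle of a homotopy `n`-sphere, `n ≥ 3`, is trivial off any point —
unconditionally.** Kervaire–Milnor 1963, proof of Thm. 3.1, p. 508, first sentence ("the only
obstruction to the triviality of `τ ⊕ ε¹` is a well defined cohomology class `oₙ(Σ)`"), in
dimensions `n ≥ 3`: `Σ ∖ {x}` is contractible (proof of Lemma 2.4, p. 507; tree theorem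
`contractibleSpace_compl_singleton_of_hurewicz_of_le` fed with the PROVED Hurewicz theorem
`Literature.AlgebraicTopology.SingularHomology.hurewicz_subsingleton_holds`), and `TΣ ⊕ ℝ` is
framed over a contractible punctured manifold
(`hasStableTangentFramingAlong_compl_singleton_of_contractibleSpace`, covering homotopy theorem
for stable framings, proved). This is the dimension-`≥ 3` part of the named fact
`hasStableTangentFramingAlong_compl_singleton`, as a theorem.
[cite: KervaireMilnorAnnals1963, §3, proof of Thm. 3.1, p. 508 (first sentence); §2, proof of Lemma 2.4, p. 507] -/
theorem hasStableTangentFramingAlong_compl_singleton_of_three_le (hn : 3 ≤ n)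
    (S : HomotopySphere n) (x : S.carrier) :
    HasStableTangentFramingAlong (𝓡 n) S.carrier
      ((↑) : ((({x} : Set S.carrier)ᶜ : Set S.carrier)) → S.carrier) :=
  hasStableTangentFramingAlong_compl_singleton_of_contractibleSpace x
    (contractibleSpace_compl_singleton_of_hurewicz_of_le
      Literature.AlgebraicTopology.SingularHomology.hurewicz_subsingleton_holds hn S x)

/-- **Kervaire–Milnor's Thm. 3.1 in dimension `n + 1 ≥ 3` from `πₙ(GL(n + 2, ℝ)) = 0` alone**:
if every continuous map from `𝕊ⁿ` to the stable frames of `ℝⁿ⁺¹` extends over `ℝⁿ⁺¹`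
(`SphereMapsToStableFramesExtend n`) and `n ≥ 2`, then every homotopy `(n+1)`-sphere is
s-parallelizable — Case 1 of the printed proof (p. 508: `n + 1 ≡ 3, 5, 6, 7 mod 8`, where
`πₙ(SO) = 0` by Bott), by the clutching theorem
`isStablyParallelizable_of_hasStableTangentFramingAlong_compl_singleton` over the now
unconditional framing off a point (`hasStableTangentFramingAlong_compl_singleton_of_three_le`).
A homotopy sphere is nonempty (it is homotopy equivalent to `𝕊ⁿ⁺¹ ∋ e₀`), so there is a point to
puncture at. Refines `isStablyParallelizable_succ_of` (which consumes the all-dimensions fact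
`hasStableTangentFramingAlong_compl_singleton`). [cite: KervaireMilnorAnnals1963, §3, Thm. 3.1 and its proof, p. 508 (Case 1)] -/
theorem isStablyParallelizable_succ_of_sphereMapsToStableFramesExtend (hn : 2 ≤ n)
    (hext : SphereMapsToStableFramesExtend n) (S : HomotopySphere (n + 1)) :
    IsStablyParallelizable (𝓡 (n + 1)) S.carrier := by
  obtain ⟨x⟩ : Nonempty S.carrier := by
    obtain ⟨e⟩ := S.nonempty_homotopyEquiv
    have : Nonempty (Metric.sphere (0 : EuclideanSpace ℝ (Fin (n + 1 + 1))) 1) :=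
      ⟨⟨EuclideanSpace.single 0 1, by simp⟩⟩
    exact ⟨e.invFun (Classical.arbitrary _)⟩
  exact isStablyParallelizable_of_hasStableTangentFramingAlong_compl_singleton hext x
    (hasStableTangentFramingAlong_compl_singleton_of_three_le (by omega) S x)

/-- **Every homotopy `7`-sphere is s-parallelizable, given Bott's `π₆(SO(8)) = 0` alone**
(Kervaire–Milnor 1963, Thm. 3.1 at `n = 7`, Case 1 of the proof, p. 508), from the named fact
`Bott1959_sphereMapsToStableFramesExtend_six`; refines `isStablyParallelizable_seven_of`.
[cite: KervaireMilnorAnnals1963, §3, Thm. 3.1, proof p. 508 (Case 1, n = 7)] [cite: Bott1959, Theorem (π₆(O) = 0)] -/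
theorem isStablyParallelizable_seven_of_bott (hB : Bott1959_sphereMapsToStableFramesExtend_six)
    (S : HomotopySphere 7) : IsStablyParallelizable (𝓡 7) S.carrier :=
  isStablyParallelizable_succ_of_sphereMapsToStableFramesExtend (by norm_num) hB S

/-- **`Θ₇ = bP₈` over its three remaining leaves.** Every homotopy `7`-sphere bounds a
parallelizable manifold (`boundsParallelizable_seven`, Kervaire–Milnor 1963, §4 with the table
p. 512; Kosinski 1993, X §6, (6.6) and p. 219), from the named facts: Bott's `π₆(SO(8)) = 0`
in extension form (`Bott1959_sphereMapsToStableFramesExtend_six`; gives Thm. 3.1 at `n = 7`,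
`isStablyParallelizable_seven_of_bott`), Lemma 4.2 in the Pontryagin–Thom direction
(`boundsParallelizable_of_collapseNullHomotopic`) and `0 ∈ p(Σ⁷)`
(`exists_collapseNullHomotopic_seven`, Lemma 4.5 with `coker J₇ = 0`), through
`boundsParallelizable_of_isStablyParallelizable_seven_of'` with Lemma 3.3 discharged
(`exists_isNormalFraming_of_isStablyParallelizable_holds`). The discharge
`boundsParallelizable_seven_holds` is this theorem applied to the three `_holds`, once they exist.
[cite: KervaireMilnorAnnals1963, Thm. 3.1 (p. 508), Lemma 3.3 (p. 509), §4 pp. 510–512 (Lemma 4.2, Lemma 4.5, table p. 512: Θ₇/bP₈ = 0)] [cite: Kosinski1993, Ch. X §6, (6.6) and p. 219] -/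
theorem boundsParallelizable_seven_of_leaves (hB : Bott1959_sphereMapsToStableFramesExtend_six)
    (h42 : boundsParallelizable_of_collapseNullHomotopic)
    (hJ : exists_collapseNullHomotopic_seven) : boundsParallelizable_seven := fun S =>
  boundsParallelizable_of_isStablyParallelizable_seven_of'
    exists_isNormalFraming_of_isStablyParallelizable_holds h42 hJ S
    (isStablyParallelizable_seven_of_bott hB S)

end HomotopySphere

end Literature.Topology.FourManifolds
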